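import Summits.Parity.BatemanHorn.Theorems.AlmostPrimeZerosSystemMomentDeficitLocalisationBlocks
import Summits.Parity.BatemanHorn.Theorems.AlmostPrimeZerosSystemMomentDeficitK1OfRoughClassDeficitAux

/-!
# Crux `SystemMomentDeficit` (stmt-Parity-11326): the mass/count split — covariance block

Route `AlmostPrimeZeros`, crux `Summit.Parity.BatemanHorn.Theses.AlmostPrimeZeros.SystemMomentDeficit`
(rank 4).  By `Localisation.systemMomentDeficit_iff_covLowerBound` the crux is, for every Bateman–Horn
system, the lower bound `Cov_x(A, B) ≥ −C` for the small COUNT `A(n) = Σᵢ #{q ∈ PP(⌊√x⌋) : q ∣ fᵢ(n)⁺ ≠ 0}`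
against the capped COUNT `B` of the prime(-square) factors beyond `√x`.  This file is the abstract
pair-expansion block behind the MASS companion of that statement
(`AlmostPrimeZerosSystemMomentDeficitMassCount.lean`): the covariance of the small count `a = Σ_t Z_t`
with the small von Mangoldt mass `r = Σ_t Λ(q_t) Z_t` (`t = (i, q)`, `q ∈ PP(z)`, `z² ≤ x`) is `O(log z)`
(`rblock_abs_le`; `cov_sum_sum_eq` is the bilinear expansion, `vonMangoldt_le_log_of_mem_PP` the weight
bound `Λ ≤ log z` on `PP(z)`).  Diagonal terms `Λ(q) Var Z_{i,q} ≤ Λ(q)·2D/q` are summed by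
`Σ_{PP(z)} Λ(q)/q ≤ 2 log z + 2` (`Ideator3Sketch.sum_PP_vonMangoldt_div_le`); coprime pairs (CRT-near,
`qq' ≤ z² ≤ x`) use the TWO termwise near-pair covariance bounds, at most `2(x+1)` of them; same-prime
pairs go as in `Localisation.ablock_ge`, all with the weight `Λ(q') ≤ log z`.

Notation (docstrings only).  `Y = x + 1`, `E g = Y⁻¹ Σ_{0 ≤ n ≤ x} g(n)`, `Cov(g, h) = E(gh) − E g · E h`,
`PP(z)` = primes `≤ z` ∪ prime squares `≤ z`, `Λ` = von Mangoldt.  Everything is [folklore].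
-/

namespace Summit.Parity.BatemanHorn.Cruxes.SystemMomentDeficit.MassCount

open scoped BigOperators
open Finset Polynomial
open Literature.NumberTheory.Sieve
open Summit.Parity.BatemanHorn.Theorems.AlmostPrimeZeros.SystemMertens
open Summit.Parity.BatemanHorn.Cruxes.SystemMomentDeficit.Ideator3Sketch
open Summit.Parity.BatemanHorn.Cruxes.SystemMomentDeficit.Localisation

/-! ### Algebra: bilinear expansion of a covariance -/

/-- `Cov(Σ_t Z_t, Σ_{t'} w_{t'} Z_{t'}) = Σ_t Σ_{t'} w_{t'} Cov(Z_t, Z_{t'})` for the empirical measure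
on `0 ≤ n ≤ x` with normalisation `Y`. [folklore] -/
theorem cov_sum_sum_eq {τ : Type*} (T : Finset τ) (Z : τ → ℕ → ℝ) (w : τ → ℝ) (x : ℕ) (Y : ℝ) :
    (∑ n ∈ range (x + 1), (∑ t ∈ T, Z t n) * (∑ t ∈ T, w t * Z t n)) / Y -
        (∑ n ∈ range (x + 1), ∑ t ∈ T, Z t n) / Y *
          ((∑ n ∈ range (x + 1), ∑ t ∈ T, w t * Z t n) / Y) =
      ∑ t ∈ T, ∑ t' ∈ T, w t' *
        ((∑ n ∈ range (x + 1), Z t n * Z t' n) / Y -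
          (∑ n ∈ range (x + 1), Z t n) / Y * ((∑ n ∈ range (x + 1), Z t' n) / Y)) := by
  have h1 : ∑ n ∈ range (x + 1), (∑ t ∈ T, Z t n) * (∑ t ∈ T, w t * Z t n) =
      ∑ t ∈ T, ∑ t' ∈ T, w t' * ∑ n ∈ range (x + 1), Z t n * Z t' n := by
    calc ∑ n ∈ range (x + 1), (∑ t ∈ T, Z t n) * (∑ t ∈ T, w t * Z t n)
        = ∑ n ∈ range (x + 1), ∑ t ∈ T, ∑ t' ∈ T, w t' * (Z t n * Z t' n) := by
          refine sum_congr rfl fun n _ => ?_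
          rw [sum_mul_sum]
          exact sum_congr rfl fun t _ => sum_congr rfl fun t' _ => by ring
      _ = ∑ t ∈ T, ∑ n ∈ range (x + 1), ∑ t' ∈ T, w t' * (Z t n * Z t' n) := sum_comm
      _ = ∑ t ∈ T, ∑ t' ∈ T, ∑ n ∈ range (x + 1), w t' * (Z t n * Z t' n) :=
          sum_congr rfl fun t _ => sum_comm
      _ = ∑ t ∈ T, ∑ t' ∈ T, w t' * ∑ n ∈ range (x + 1), Z t n * Z t' n :=
          sum_congr rfl fun t _ => sum_congr rfl fun t' _ => by rw [mul_sum]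
  have h2 : ∑ n ∈ range (x + 1), ∑ t ∈ T, Z t n = ∑ t ∈ T, ∑ n ∈ range (x + 1), Z t n := sum_comm
  have h3 : ∑ n ∈ range (x + 1), ∑ t ∈ T, w t * Z t n = ∑ t ∈ T, w t * ∑ n ∈ range (x + 1), Z t n := by
    rw [sum_comm]
    exact sum_congr rfl fun t _ => by rw [mul_sum]
  rw [h1, h2, h3, sum_div, sum_div, sum_div, sum_mul_sum]
  rw [← sum_sub_distrib]
  refine sum_congr rfl fun t _ => ?_
  rw [sum_div, ← sum_sub_distrib]
  refine sum_congr rfl fun t' _ => ?_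
  ring

/-! ### The von Mangoldt weight on `PP(z)` -/

/-- On `PP(z)` the von Mangoldt weight is at most `log z`: `Λ(p) = log p ≤ log z` for `p ≤ z`, and
`Λ(p²) = log p ≤ log z` for `p² ≤ z`. [folklore] -/
theorem vonMangoldt_le_log_of_mem_PP {z q : ℕ}
    (hq : q ∈ (Nat.primesLE z ∪ ((Nat.primesLE z).filter (fun p => p ^ 2 ≤ z)).image (fun p => p ^ 2))) :
    ArithmeticFunction.vonMangoldt q ≤ Real.log z := by
  rcases mem_PP_iff.1 hq with ⟨hp, hpz⟩ | ⟨p, hp, hpz, rfl⟩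
  · rw [ArithmeticFunction.vonMangoldt_apply_prime hp]
    exact Real.log_le_log (by exact_mod_cast hp.pos) (by exact_mod_cast hpz)
  · rw [ArithmeticFunction.vonMangoldt_apply_pow two_ne_zero, ArithmeticFunction.vonMangoldt_apply_prime hp]
    have h1 : (p : ℝ) ≤ (p : ℝ) ^ 2 := by
      have : (1 : ℝ) ≤ p := by exact_mod_cast hp.one_lt.le
      nlinarith
    have h2 : ((p : ℝ) ^ 2) ≤ (z : ℝ) := by exact_mod_cast hpz
    exact Real.log_le_log (by exact_mod_cast hp.pos) (h1.trans h2)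

/-! ### Block `|Cov(a, r)| = O(log z)` -/

set_option maxHeartbeats 800000 in -- one long bookkeeping proof (≈ 2× the default budget)
/-- **Block `|Cov(a, r)| = O(log z)`** (`z² ≤ x`): pair expansion over `(univ ×ˢ PP(z))²` of the covariance
of the small count `a = Σ_t Z_t` with the small von Mangoldt mass `r = Σ_t Λ(q_t) Z_t` of a system `f`;
diagonal terms `Λ(q)(E Z − (E Z)²) ∈ [0, Λ(q)·2D/q]` sum to `≤ 2Dk(2 log z + 2)`, every other term carries
the weight `Λ(q') ≤ log z` and is bounded as in the blocks `E a − Var a = O(1)` (coprime pairs: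
`|Cov| ≤ (C_S + C_U)/(x+1)`, at most `2(x+1)` of them; same prime: `E(ZZ') + E Z·E Z' ≤ 2D/max(q,q') +
((P₀+1)⁴ + 4D²)/(qq')`, the cross-member product vanishing for `p > P₀`). [folklore] -/
theorem rblock_abs_le :
    ∀ (k : ℕ) (f : Fin k → ℤ[X]) (x z P₀ : ℕ) (Zf : Fin k × ℕ → ℕ → ℝ) (D CpS CpU : ℝ)
    (_hD : 0 ≤ D) (hCpS : 0 ≤ CpS) (hCpU : 0 ≤ CpU) (hzx : z ≤ x) (hzz : z * z ≤ x)
    (hZfdef : ∀ t n, Zf t n =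
      if t.2 ∣ ((f t.1).eval (n : ℤ)).toNat ∧ ((f t.1).eval (n : ℤ)).toNat ≠ 0 then 1 else 0)
    (he : ∀ t : Fin k × ℕ, t.2 ∈ (Nat.primesLE x ∪ ((Nat.primesLE x).filter (fun p => p ^ 2 ≤ x)).image (fun p => p ^ 2)) →
      (∑ n ∈ range (x + 1), Zf t n) / ((x : ℝ) + 1) ≤ 2 * D / (t.2 : ℝ))
    (hpair : ∀ t t' : Fin k × ℕ, t.2 ∈ (Nat.primesLE x ∪ ((Nat.primesLE x).filter (fun p => p ^ 2 ≤ x)).image (fun p => p ^ 2)) → t'.2 ∈ (Nat.primesLE x ∪ ((Nat.primesLE x).filter (fun p => p ^ 2 ≤ x)).image (fun p => p ^ 2)) → Nat.Coprime t.2 t'.2 →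
      (∑ n ∈ range (x + 1), Zf t n) / ((x : ℝ) + 1) * ((∑ n ∈ range (x + 1), Zf t' n) / ((x : ℝ) + 1)) -
        (∑ n ∈ range (x + 1), Zf t n * Zf t' n) / ((x : ℝ) + 1) ≤ CpS / ((x : ℝ) + 1))
    (hpairU : ∀ t t' : Fin k × ℕ, t.2 ∈ (Nat.primesLE x ∪ ((Nat.primesLE x).filter (fun p => p ^ 2 ≤ x)).image (fun p => p ^ 2)) → t'.2 ∈ (Nat.primesLE x ∪ ((Nat.primesLE x).filter (fun p => p ^ 2 ≤ x)).image (fun p => p ^ 2)) → Nat.Coprime t.2 t'.2 →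
      (∑ n ∈ range (x + 1), Zf t n * Zf t' n) / ((x : ℝ) + 1) -
        (∑ n ∈ range (x + 1), Zf t n) / ((x : ℝ) + 1) * ((∑ n ∈ range (x + 1), Zf t' n) / ((x : ℝ) + 1)) ≤
        CpU / ((x : ℝ) + 1))
    (hcross : ∀ i j : Fin k, i ≠ j → ∀ p : ℕ, P₀ < p → ∀ n : ℤ,
      ¬ ((p : ℤ) ∣ (f i).eval n ∧ (p : ℤ) ∣ (f j).eval n))
    (hcnt : #(((Nat.primesLE x ∪ ((Nat.primesLE x).filter (fun p => p ^ 2 ≤ x)).image (fun p => p ^ 2)) ×ˢ (Nat.primesLE x ∪ ((Nat.primesLE x).filter (fun p => p ^ 2 ≤ x)).image (fun p => p ^ 2))).filter (fun qq : ℕ × ℕ => Nat.Coprime qq.1 qq.2 ∧ qq.1 * qq.2 ≤ x)) ≤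
      2 * (x + 1))
    (h8 : ∑ qq ∈ ((Nat.primesLE x ∪ ((Nat.primesLE x).filter (fun p => p ^ 2 ≤ x)).image (fun p => p ^ 2)) ×ˢ (Nat.primesLE x ∪ ((Nat.primesLE x).filter (fun p => p ^ 2 ≤ x)).image (fun p => p ^ 2))).filter (fun qq : ℕ × ℕ => ¬ Nat.Coprime qq.1 qq.2),
      (1 : ℝ) / ((qq.1 : ℝ) * (qq.2 : ℝ)) ≤ 8),
    |(∑ n ∈ range (x + 1), (∑ t ∈ (univ : Finset (Fin k)) ×ˢ (Nat.primesLE z ∪ ((Nat.primesLE z).filter (fun p => p ^ 2 ≤ z)).image (fun p => p ^ 2)), Zf t n) *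
          (∑ t ∈ (univ : Finset (Fin k)) ×ˢ (Nat.primesLE z ∪ ((Nat.primesLE z).filter (fun p => p ^ 2 ≤ z)).image (fun p => p ^ 2)), ArithmeticFunction.vonMangoldt t.2 * Zf t n)) / ((x : ℝ) + 1) -
        (∑ n ∈ range (x + 1), ∑ t ∈ (univ : Finset (Fin k)) ×ˢ (Nat.primesLE z ∪ ((Nat.primesLE z).filter (fun p => p ^ 2 ≤ z)).image (fun p => p ^ 2)), Zf t n) / ((x : ℝ) + 1) *
          ((∑ n ∈ range (x + 1), ∑ t ∈ (univ : Finset (Fin k)) ×ˢ (Nat.primesLE z ∪ ((Nat.primesLE z).filter (fun p => p ^ 2 ≤ z)).image (fun p => p ^ 2)), ArithmeticFunction.vonMangoldt t.2 * Zf t n) / ((x : ℝ) + 1))| ≤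
      Real.log z * ((k : ℝ) ^ 2 * (2 * (CpS + CpU) + 8 * (((P₀ : ℝ) + 1) ^ 4 + 4 * D ^ 2) + 4 * D)) +
        (k : ℝ) * (2 * D) * (2 * Real.log z + 2) := by
  intro k f x z P₀ Zf D CpS CpU hD hCpS hCpU hzx hzz hZfdef he hpair hpairU hcross hcnt h8
  classical
  set M₀ : ℝ := ((P₀ : ℝ) + 1) ^ 4 with hM₀
  set Lz : ℝ := Real.log z with hLz
  have hM₀0 : 0 ≤ M₀ := by positivity
  have hY0 : (0 : ℝ) < (x : ℝ) + 1 := by positivity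
  have hLz0 : 0 ≤ Lz := Real.log_natCast_nonneg z
  have hΛ0 : ∀ q : ℕ, 0 ≤ ArithmeticFunction.vonMangoldt q := fun q => ArithmeticFunction.vonMangoldt_nonneg
  have hZf01 : ∀ t n, Zf t n = 0 ∨ Zf t n = 1 := fun t n => by rw [hZfdef]; split_ifs <;> simp
  have hZf0 : ∀ t n, 0 ≤ Zf t n := fun t n => by rcases hZf01 t n with h | h <;> simp [h]
  have hZf1 : ∀ t n, Zf t n ≤ 1 := fun t n => by rcases hZf01 t n with h | h <;> simp [h]
  have hmemx : ∀ t ∈ (univ : Finset (Fin k)) ×ˢ (Nat.primesLE z ∪ ((Nat.primesLE z).filter (fun p => p ^ 2 ≤ z)).image (fun p => p ^ 2)), t.2 ∈ (Nat.primesLE x ∪ ((Nat.primesLE x).filter (fun p => p ^ 2 ≤ x)).image (fun p => p ^ 2)) := fun t ht => PP_mono hzx (mem_product.1 ht).2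
  have he0 : ∀ t : Fin k × ℕ, 0 ≤ (∑ n ∈ range (x + 1), Zf t n) / ((x : ℝ) + 1) := fun t => div_nonneg (sum_nonneg fun n _ => hZf0 t n) hY0.le
  have he1 : ∀ t : Fin k × ℕ, (∑ n ∈ range (x + 1), Zf t n) / ((x : ℝ) + 1) ≤ 1 := fun t => by
    rw [div_le_one hY0]
    refine (sum_le_sum fun n _ => hZf1 t n).trans (le_of_eq ?_)
    rw [sum_const, card_range, nsmul_eq_mul, mul_one]; push_cast; ring
  have he2_0 : ∀ t t' : Fin k × ℕ, 0 ≤ (∑ n ∈ range (x + 1), Zf t n * Zf t' n) / ((x : ℝ) + 1) := fun t t' => div_nonneg (sum_nonneg fun n _ => mul_nonneg (hZf0 t n) (hZf0 t' n)) hY0.le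
  have hE2_le_left : ∀ t t' : Fin k × ℕ, (∑ n ∈ range (x + 1), Zf t n * Zf t' n) / ((x : ℝ) + 1) ≤
      (∑ n ∈ range (x + 1), Zf t n) / ((x : ℝ) + 1) := fun t t' =>
    div_le_div_of_nonneg_right (sum_le_sum fun n _ => by nlinarith [hZf1 t' n, hZf0 t n, hZf0 t' n]) hY0.le
  have hE2_le_right : ∀ t t' : Fin k × ℕ, (∑ n ∈ range (x + 1), Zf t n * Zf t' n) / ((x : ℝ) + 1) ≤
      (∑ n ∈ range (x + 1), Zf t' n) / ((x : ℝ) + 1) := fun t t' =>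
    div_le_div_of_nonneg_right (sum_le_sum fun n _ => by nlinarith [hZf1 t n, hZf0 t n, hZf0 t' n]) hY0.le
  have hE2_le_one : ∀ t t' : Fin k × ℕ, (∑ n ∈ range (x + 1), Zf t n * Zf t' n) / ((x : ℝ) + 1) ≤ 1 := fun t t' => (hE2_le_left t t').trans (he1 t)
  -- cross-member same-prime products vanish for `p > P₀`
  have hvanish : ∀ (i j : Fin k) (q q' p : ℕ), i ≠ j → p.Prime → P₀ < p → p ∣ q → p ∣ q' →
      ∀ n : ℕ, Zf (i, q) n * Zf (j, q') n = 0 := by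
    intro i j q q' p hij hp hP hpq hpq' n
    rw [hZfdef (i, q) n, hZfdef (j, q') n]
    split_ifs with h1 h2
    · exact absurd ⟨(Int.natCast_dvd_natCast.2 hpq).trans (dvd_toNat_and_ne_zero_iff.1 h1).2,
        (Int.natCast_dvd_natCast.2 hpq').trans (dvd_toNat_and_ne_zero_iff.1 h2).2⟩ (hcross i j hij p hP (n : ℤ))
    all_goals simp
  rw [cov_sum_sum_eq]
  -- termwise bound
  have hterm : ∀ t ∈ (univ : Finset (Fin k)) ×ˢ (Nat.primesLE z ∪ ((Nat.primesLE z).filter (fun p => p ^ 2 ≤ z)).image (fun p => p ^ 2)), ∀ t' ∈ (univ : Finset (Fin k)) ×ˢ (Nat.primesLE z ∪ ((Nat.primesLE z).filter (fun p => p ^ 2 ≤ z)).image (fun p => p ^ 2)),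
      |ArithmeticFunction.vonMangoldt t'.2 *
        ((∑ n ∈ range (x + 1), Zf t n * Zf t' n) / ((x : ℝ) + 1) -
          (∑ n ∈ range (x + 1), Zf t n) / ((x : ℝ) + 1) * ((∑ n ∈ range (x + 1), Zf t' n) / ((x : ℝ) + 1)))| ≤
      (if t = t' then ArithmeticFunction.vonMangoldt t.2 * (2 * D / (t.2 : ℝ)) else 0) +
        Lz * (if Nat.Coprime t.2 t'.2 then (CpS + CpU) / ((x : ℝ) + 1)
          else (M₀ + 4 * D ^ 2) / ((t.2 : ℝ) * (t'.2 : ℝ)) +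
            (if t.2 = t'.2 then 0 else 2 * D / ((max t.2 t'.2 : ℕ) : ℝ))) := by
    rintro ⟨i, q⟩ ht ⟨j, q'⟩ ht'
    have hqz : q ∈ (Nat.primesLE z ∪ ((Nat.primesLE z).filter (fun p => p ^ 2 ≤ z)).image (fun p => p ^ 2)) := (mem_product.1 ht).2
    have hq'z : q' ∈ (Nat.primesLE z ∪ ((Nat.primesLE z).filter (fun p => p ^ 2 ≤ z)).image (fun p => p ^ 2)) := (mem_product.1 ht').2
    have htx := hmemx _ ht
    have ht'x := hmemx _ ht'
    simp only at htx ht'x ⊢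
    have hΛq' : ArithmeticFunction.vonMangoldt q' ≤ Lz := vonMangoldt_le_log_of_mem_PP hq'z
    have hΛq : ArithmeticFunction.vonMangoldt q ≤ Lz := vonMangoldt_le_log_of_mem_PP hqz
    have hq0 : (0 : ℝ) < q := by
      have := (isPrimePow_and_le_of_mem_PP htx).2.1; exact_mod_cast (by omega)
    have hq'0 : (0 : ℝ) < q' := by
      have := (isPrimePow_and_le_of_mem_PP ht'x).2.1; exact_mod_cast (by omega)
    rw [abs_mul, abs_of_nonneg (hΛ0 q')]
    by_cases hcop : Nat.Coprime q q'
    · -- coprime pair: `|Cov| ≤ (CpS + CpU)/(x+1)`, weight `Λ(q') ≤ log z`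
      have hne : ((i, q) : Fin k × ℕ) ≠ (j, q') := by
        intro h
        have hqq : q = q' := (Prod.ext_iff.1 h).2
        subst hqq
        have h2 := (isPrimePow_and_le_of_mem_PP htx).2.1
        rw [Nat.coprime_self] at hcop
        omega
      rw [if_neg hne, if_pos hcop, zero_add]
      have h1 := hpair (i, q) (j, q') htx ht'x hcop
      have h2 := hpairU (i, q) (j, q') htx ht'x hcop
      have habs : |(∑ n ∈ range (x + 1), Zf (i, q) n * Zf (j, q') n) / ((x : ℝ) + 1) -
          (∑ n ∈ range (x + 1), Zf (i, q) n) / ((x : ℝ) + 1) * ((∑ n ∈ range (x + 1), Zf (j, q') n) / ((x : ℝ) + 1))| ≤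
          (CpS + CpU) / ((x : ℝ) + 1) := by
        rw [abs_le, add_div]
        have h3 : 0 ≤ CpS / ((x : ℝ) + 1) := div_nonneg hCpS hY0.le
        have h4 : 0 ≤ CpU / ((x : ℝ) + 1) := div_nonneg hCpU hY0.le
        constructor <;> linarith
      exact mul_le_mul hΛq' habs (abs_nonneg _) hLz0
    · rw [if_neg hcop]
      have hMqq : 0 ≤ (M₀ + 4 * D ^ 2) / ((q : ℝ) * (q' : ℝ)) := by positivity
      obtain ⟨p, hp, hpz, hq, hq'⟩ := exists_prime_of_not_coprime_of_mem_PP hqz hq'z hcop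
      have hpq : p ∣ q := by rcases hq with rfl | ⟨rfl, -⟩ <;> simp
      have hpq' : p ∣ q' := by rcases hq' with rfl | ⟨rfl, -⟩ <;> simp
      -- `E Z · E Z' ≤ 4D²/(qq')`
      have hprod : (∑ n ∈ range (x + 1), Zf (i, q) n) / ((x : ℝ) + 1) *
          ((∑ n ∈ range (x + 1), Zf (j, q') n) / ((x : ℝ) + 1)) ≤ 4 * D ^ 2 / ((q : ℝ) * (q' : ℝ)) := by
        have h1 := he (i, q) htx
        have h2 := he (j, q') ht'x
        simp only at h1 h2
        calc (∑ n ∈ range (x + 1), Zf (i, q) n) / ((x : ℝ) + 1) *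
              ((∑ n ∈ range (x + 1), Zf (j, q') n) / ((x : ℝ) + 1))
            ≤ (2 * D / (q : ℝ)) * (2 * D / (q' : ℝ)) :=
              mul_le_mul h1 h2 (he0 (j, q')) (le_trans (he0 (i, q)) h1)
          _ = 4 * D ^ 2 / ((q : ℝ) * (q' : ℝ)) := by
              field_simp
              ring
      have hprod0 := mul_nonneg (he0 (i, q)) (he0 (j, q'))
      by_cases heq : ((i, q) : Fin k × ℕ) = (j, q')
      · -- diagonal: `0 ≤ E Z − (E Z)² ≤ E Z ≤ 2D/q`
        have hqq : q = q' := (Prod.ext_iff.1 heq).2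
        have hij : i = j := (Prod.ext_iff.1 heq).1
        subst hqq; subst hij
        rw [if_pos rfl, if_pos rfl, add_zero]
        have hdiag : ∑ n ∈ range (x + 1), Zf (i, q) n * Zf (i, q) n = ∑ n ∈ range (x + 1), Zf (i, q) n :=
          sum_congr rfl fun n _ => by rcases hZf01 (i, q) n with h | h <;> simp [h]
        rw [hdiag]
        have h1 := he (i, q) htx
        simp only at h1
        have hcov0 : 0 ≤ (∑ n ∈ range (x + 1), Zf (i, q) n) / ((x : ℝ) + 1) -
            (∑ n ∈ range (x + 1), Zf (i, q) n) / ((x : ℝ) + 1) * ((∑ n ∈ range (x + 1), Zf (i, q) n) / ((x : ℝ) + 1)) := by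
          nlinarith [he0 (i, q), he1 (i, q)]
        have hcov1 : (∑ n ∈ range (x + 1), Zf (i, q) n) / ((x : ℝ) + 1) -
            (∑ n ∈ range (x + 1), Zf (i, q) n) / ((x : ℝ) + 1) * ((∑ n ∈ range (x + 1), Zf (i, q) n) / ((x : ℝ) + 1)) ≤
            2 * D / (q : ℝ) := by nlinarith [he0 (i, q)]
        rw [abs_of_nonneg hcov0]
        have hL : 0 ≤ Lz * ((M₀ + 4 * D ^ 2) / ((q : ℝ) * (q : ℝ))) := mul_nonneg hLz0 hMqq
        calc ArithmeticFunction.vonMangoldt q * ((∑ n ∈ range (x + 1), Zf (i, q) n) / ((x : ℝ) + 1) -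
              (∑ n ∈ range (x + 1), Zf (i, q) n) / ((x : ℝ) + 1) * ((∑ n ∈ range (x + 1), Zf (i, q) n) / ((x : ℝ) + 1)))
            ≤ ArithmeticFunction.vonMangoldt q * (2 * D / (q : ℝ)) :=
              mul_le_mul_of_nonneg_left hcov1 (hΛ0 q)
          _ ≤ ArithmeticFunction.vonMangoldt q * (2 * D / (q : ℝ)) + Lz * ((M₀ + 4 * D ^ 2) / ((q : ℝ) * (q : ℝ))) :=
              le_add_of_nonneg_right hL
      · rw [if_neg heq, zero_add]
        -- `|Cov| ≤ E(ZZ') + E Z · E Z'`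
        have habs : |(∑ n ∈ range (x + 1), Zf (i, q) n * Zf (j, q') n) / ((x : ℝ) + 1) -
            (∑ n ∈ range (x + 1), Zf (i, q) n) / ((x : ℝ) + 1) * ((∑ n ∈ range (x + 1), Zf (j, q') n) / ((x : ℝ) + 1))| ≤
            (∑ n ∈ range (x + 1), Zf (i, q) n * Zf (j, q') n) / ((x : ℝ) + 1) +
              (∑ n ∈ range (x + 1), Zf (i, q) n) / ((x : ℝ) + 1) * ((∑ n ∈ range (x + 1), Zf (j, q') n) / ((x : ℝ) + 1)) := by
          rw [abs_le]
          have h1 := he2_0 (i, q) (j, q')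
          constructor <;> linarith
        by_cases hij : i = j
        · -- same member, `{q, q'} = {p, p²}`: `E(ZZ') ≤ E Z_{i,p²} ≤ 2D/p²`
          subst hij
          have hqne : q ≠ q' := fun h => heq (by rw [h])
          rw [if_neg hqne]
          have hp2x : ∀ (h : p ^ 2 ≤ z), p ^ 2 ∈ (Nat.primesLE x ∪ ((Nat.primesLE x).filter (fun p => p ^ 2 ≤ x)).image (fun p => p ^ 2)) :=
            fun h => PP_mono hzx (mem_PP_iff.2 (Or.inr ⟨p, hp, h, rfl⟩))
          have hkey : (∑ n ∈ range (x + 1), Zf (i, q) n * Zf (i, q') n) / ((x : ℝ) + 1) ≤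
              2 * D / ((max q q' : ℕ) : ℝ) := by
            rcases hq with rfl | ⟨rfl, hz1⟩ <;> rcases hq' with rfl | ⟨rfl, hz2⟩
            · exact absurd rfl hqne
            · rw [max_eq_right (Nat.le_self_pow two_ne_zero _)]
              exact (hE2_le_right _ _).trans (he (i, _) (hp2x hz2))
            · rw [max_eq_left (Nat.le_self_pow two_ne_zero _)]
              exact (hE2_le_left _ _).trans (he (i, _) (hp2x hz1))
            · exact absurd rfl hqne
          calc ArithmeticFunction.vonMangoldt q' * |(∑ n ∈ range (x + 1), Zf (i, q) n * Zf (i, q') n) / ((x : ℝ) + 1) -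
                (∑ n ∈ range (x + 1), Zf (i, q) n) / ((x : ℝ) + 1) * ((∑ n ∈ range (x + 1), Zf (i, q') n) / ((x : ℝ) + 1))|
              ≤ Lz * (2 * D / ((max q q' : ℕ) : ℝ) + 4 * D ^ 2 / ((q : ℝ) * (q' : ℝ))) :=
                mul_le_mul hΛq' (habs.trans (add_le_add hkey hprod)) (abs_nonneg _) hLz0
            _ ≤ Lz * ((M₀ + 4 * D ^ 2) / ((q : ℝ) * (q' : ℝ)) + 2 * D / ((max q q' : ℕ) : ℝ)) := by
                refine mul_le_mul_of_nonneg_left ?_ hLz0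
                rw [add_div]
                have : 0 ≤ M₀ / ((q : ℝ) * (q' : ℝ)) := by positivity
                linarith
        · -- cross members, same prime `p`: vanishes for `p > P₀`, else `≤ 1 ≤ M₀/(qq')`
          have hkey : (∑ n ∈ range (x + 1), Zf (i, q) n * Zf (j, q') n) / ((x : ℝ) + 1) ≤
              M₀ / ((q : ℝ) * (q' : ℝ)) := by
            by_cases hP : P₀ < p
            · have h0 : ∑ n ∈ range (x + 1), Zf (i, q) n * Zf (j, q') n = 0 :=
                sum_eq_zero fun n _ => hvanish i j q q' p hij hp hP hpq hpq' n
              rw [h0, zero_div]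
              positivity
            · have hpP : p ≤ P₀ := not_lt.1 hP
              have hqle : q ≤ p ^ 2 := by
                rcases hq with rfl | ⟨rfl, -⟩; exacts [Nat.le_self_pow two_ne_zero _, le_rfl]
              have hq'le : q' ≤ p ^ 2 := by
                rcases hq' with rfl | ⟨rfl, -⟩; exacts [Nat.le_self_pow two_ne_zero _, le_rfl]
              have hpR : (p : ℝ) ≤ (P₀ : ℝ) + 1 := by
                have : (p : ℝ) ≤ P₀ := by exact_mod_cast hpP
                linarith
              have hp2 : (p : ℝ) ^ 2 ≤ ((P₀ : ℝ) + 1) ^ 2 := by gcongr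
              have hqR : (q : ℝ) ≤ ((P₀ : ℝ) + 1) ^ 2 := le_trans (by exact_mod_cast hqle) hp2
              have hq'R : (q' : ℝ) ≤ ((P₀ : ℝ) + 1) ^ 2 := le_trans (by exact_mod_cast hq'le) hp2
              have hprod' : (q : ℝ) * (q' : ℝ) ≤ M₀ := by
                calc (q : ℝ) * (q' : ℝ) ≤ ((P₀ : ℝ) + 1) ^ 2 * ((P₀ : ℝ) + 1) ^ 2 :=
                      mul_le_mul hqR hq'R hq'0.le (by positivity)
                  _ = M₀ := by rw [hM₀]; ring
              refine (hE2_le_one _ _).trans ?_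
              rw [le_div_iff₀ (mul_pos hq0 hq'0), one_mul]
              exact hprod'
          have hsnd : 0 ≤ (if q = q' then (0 : ℝ) else 2 * D / ((max q q' : ℕ) : ℝ)) := by
            split_ifs
            · exact le_rfl
            · positivity
          calc ArithmeticFunction.vonMangoldt q' * |(∑ n ∈ range (x + 1), Zf (i, q) n * Zf (j, q') n) / ((x : ℝ) + 1) -
                (∑ n ∈ range (x + 1), Zf (i, q) n) / ((x : ℝ) + 1) * ((∑ n ∈ range (x + 1), Zf (j, q') n) / ((x : ℝ) + 1))|
              ≤ Lz * (M₀ / ((q : ℝ) * (q' : ℝ)) + 4 * D ^ 2 / ((q : ℝ) * (q' : ℝ))) :=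
                mul_le_mul hΛq' (habs.trans (add_le_add hkey hprod)) (abs_nonneg _) hLz0
            _ ≤ Lz * ((M₀ + 4 * D ^ 2) / ((q : ℝ) * (q' : ℝ)) +
                (if q = q' then (0 : ℝ) else 2 * D / ((max q q' : ℕ) : ℝ))) := by
                refine mul_le_mul_of_nonneg_left ?_ hLz0
                rw [add_div]
                linarith
  refine (abs_sum_le_sum_abs _ _).trans ?_
  refine (sum_le_sum fun t _ => abs_sum_le_sum_abs _ _).trans ?_
  refine (sum_le_sum fun t ht => sum_le_sum fun t' ht' => hterm t ht t' ht').trans ?_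
  rw [sum_congr rfl fun t _ => sum_add_distrib, sum_add_distrib]
  -- diagonal part: `Σ_t Λ(q_t)·2D/q_t ≤ 2Dk(2 log z + 2)`
  have hdiag : ∑ t ∈ (univ : Finset (Fin k)) ×ˢ (Nat.primesLE z ∪ ((Nat.primesLE z).filter (fun p => p ^ 2 ≤ z)).image (fun p => p ^ 2)),
      ∑ t' ∈ (univ : Finset (Fin k)) ×ˢ (Nat.primesLE z ∪ ((Nat.primesLE z).filter (fun p => p ^ 2 ≤ z)).image (fun p => p ^ 2)),
        (if t = t' then ArithmeticFunction.vonMangoldt t.2 * (2 * D / (t.2 : ℝ)) else 0) ≤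
      (k : ℝ) * (2 * D) * (2 * Real.log z + 2) := by
    rw [sum_congr rfl fun t ht => sum_ite_eq (univ ×ˢ _) t _]
    simp only [mem_product, mem_univ, true_and]
    rw [sum_congr rfl fun t ht => if_pos (mem_product.1 ht).2, sum_product]
    simp only [sum_const, card_univ, Fintype.card_fin, nsmul_eq_mul]
    have h1 := sum_PP_vonMangoldt_div_le z
    calc (k : ℝ) * ∑ q ∈ (Nat.primesLE z ∪ ((Nat.primesLE z).filter (fun p => p ^ 2 ≤ z)).image (fun p => p ^ 2)),
          ArithmeticFunction.vonMangoldt q * (2 * D / (q : ℝ))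
        = (k : ℝ) * (2 * D) * ∑ q ∈ (Nat.primesLE z ∪ ((Nat.primesLE z).filter (fun p => p ^ 2 ≤ z)).image (fun p => p ^ 2)),
            ArithmeticFunction.vonMangoldt q / (q : ℝ) := by
          rw [mul_assoc]
          congr 1
          rw [mul_sum]
          exact sum_congr rfl fun q _ => by ring
      _ ≤ (k : ℝ) * (2 * D) * (2 * Real.log z + 2) := by gcongr
  -- off-diagonal part with the weight `log z`
  have hoff : ∑ t ∈ (univ : Finset (Fin k)) ×ˢ (Nat.primesLE z ∪ ((Nat.primesLE z).filter (fun p => p ^ 2 ≤ z)).image (fun p => p ^ 2)),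
      ∑ t' ∈ (univ : Finset (Fin k)) ×ˢ (Nat.primesLE z ∪ ((Nat.primesLE z).filter (fun p => p ^ 2 ≤ z)).image (fun p => p ^ 2)),
        Lz * (if Nat.Coprime t.2 t'.2 then (CpS + CpU) / ((x : ℝ) + 1)
          else (M₀ + 4 * D ^ 2) / ((t.2 : ℝ) * (t'.2 : ℝ)) +
            (if t.2 = t'.2 then 0 else 2 * D / ((max t.2 t'.2 : ℕ) : ℝ))) ≤
      Lz * ((k : ℝ) ^ 2 * (2 * (CpS + CpU) + 8 * (M₀ + 4 * D ^ 2) + 4 * D)) := by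
    simp_rw [← mul_sum]
    refine mul_le_mul_of_nonneg_left ?_ hLz0
    rw [sum_univ_prod_sum_univ_prod (k := k) ((Nat.primesLE z ∪ ((Nat.primesLE z).filter (fun p => p ^ 2 ≤ z)).image (fun p => p ^ 2))) ((Nat.primesLE z ∪ ((Nat.primesLE z).filter (fun p => p ^ 2 ≤ z)).image (fun p => p ^ 2))) (fun q q' =>
      if Nat.Coprime q q' then (CpS + CpU) / ((x : ℝ) + 1)
      else (M₀ + 4 * D ^ 2) / ((q : ℝ) * (q' : ℝ)) + (if q = q' then 0 else 2 * D / ((max q q' : ℕ) : ℝ)))]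
    refine mul_le_mul_of_nonneg_left ?_ (by positivity)
    rw [sum_ite]
    have hcnt' : (#(((Nat.primesLE z ∪ ((Nat.primesLE z).filter (fun p => p ^ 2 ≤ z)).image (fun p => p ^ 2)) ×ˢ (Nat.primesLE z ∪ ((Nat.primesLE z).filter (fun p => p ^ 2 ≤ z)).image (fun p => p ^ 2))).filter (fun qq : ℕ × ℕ => Nat.Coprime qq.1 qq.2)) : ℝ) ≤
        2 * ((x : ℝ) + 1) := by
      have h2 : #(((Nat.primesLE z ∪ ((Nat.primesLE z).filter (fun p => p ^ 2 ≤ z)).image (fun p => p ^ 2)) ×ˢ (Nat.primesLE z ∪ ((Nat.primesLE z).filter (fun p => p ^ 2 ≤ z)).image (fun p => p ^ 2))).filter (fun qq : ℕ × ℕ => Nat.Coprime qq.1 qq.2)) ≤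
          #(((Nat.primesLE x ∪ ((Nat.primesLE x).filter (fun p => p ^ 2 ≤ x)).image (fun p => p ^ 2)) ×ˢ (Nat.primesLE x ∪ ((Nat.primesLE x).filter (fun p => p ^ 2 ≤ x)).image (fun p => p ^ 2))).filter (fun qq : ℕ × ℕ => Nat.Coprime qq.1 qq.2 ∧ qq.1 * qq.2 ≤ x)) := by
        refine card_le_card fun qq hqq => ?_
        rw [mem_filter, mem_product] at hqq ⊢
        obtain ⟨⟨h1, h2⟩, hc⟩ := hqq
        refine ⟨⟨PP_mono hzx h1, PP_mono hzx h2⟩, hc, ?_⟩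
        exact le_trans (Nat.mul_le_mul (isPrimePow_and_le_of_mem_PP h1).2.2
          (isPrimePow_and_le_of_mem_PP h2).2.2) hzz
      exact_mod_cast h2.trans hcnt
    have hA : ∑ qq ∈ ((Nat.primesLE z ∪ ((Nat.primesLE z).filter (fun p => p ^ 2 ≤ z)).image (fun p => p ^ 2)) ×ˢ (Nat.primesLE z ∪ ((Nat.primesLE z).filter (fun p => p ^ 2 ≤ z)).image (fun p => p ^ 2))).filter (fun qq : ℕ × ℕ => Nat.Coprime qq.1 qq.2),
        (CpS + CpU) / ((x : ℝ) + 1) ≤ 2 * (CpS + CpU) := by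
      rw [sum_const, nsmul_eq_mul]
      calc _ ≤ 2 * ((x : ℝ) + 1) * ((CpS + CpU) / ((x : ℝ) + 1)) :=
            mul_le_mul_of_nonneg_right hcnt' (div_nonneg (add_nonneg hCpS hCpU) hY0.le)
        _ = 2 * (CpS + CpU) := by field_simp
    have hB1 : ∑ qq ∈ ((Nat.primesLE z ∪ ((Nat.primesLE z).filter (fun p => p ^ 2 ≤ z)).image (fun p => p ^ 2)) ×ˢ (Nat.primesLE z ∪ ((Nat.primesLE z).filter (fun p => p ^ 2 ≤ z)).image (fun p => p ^ 2))).filter (fun qq : ℕ × ℕ => ¬ Nat.Coprime qq.1 qq.2),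
        (M₀ + 4 * D ^ 2) / ((qq.1 : ℝ) * (qq.2 : ℝ)) ≤ (M₀ + 4 * D ^ 2) * 8 := by
      have hM4 : 0 ≤ M₀ + 4 * D ^ 2 := by positivity
      calc ∑ qq ∈ ((Nat.primesLE z ∪ ((Nat.primesLE z).filter (fun p => p ^ 2 ≤ z)).image (fun p => p ^ 2)) ×ˢ (Nat.primesLE z ∪ ((Nat.primesLE z).filter (fun p => p ^ 2 ≤ z)).image (fun p => p ^ 2))).filter (fun qq : ℕ × ℕ => ¬ Nat.Coprime qq.1 qq.2),
            (M₀ + 4 * D ^ 2) / ((qq.1 : ℝ) * (qq.2 : ℝ))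
          = (M₀ + 4 * D ^ 2) * ∑ qq ∈ ((Nat.primesLE z ∪ ((Nat.primesLE z).filter (fun p => p ^ 2 ≤ z)).image (fun p => p ^ 2)) ×ˢ (Nat.primesLE z ∪ ((Nat.primesLE z).filter (fun p => p ^ 2 ≤ z)).image (fun p => p ^ 2))).filter (fun qq : ℕ × ℕ => ¬ Nat.Coprime qq.1 qq.2),
              (1 : ℝ) / ((qq.1 : ℝ) * (qq.2 : ℝ)) := by
            rw [mul_sum]
            exact sum_congr rfl fun qq _ => by ring
        _ ≤ (M₀ + 4 * D ^ 2) * ∑ qq ∈ ((Nat.primesLE x ∪ ((Nat.primesLE x).filter (fun p => p ^ 2 ≤ x)).image (fun p => p ^ 2)) ×ˢ (Nat.primesLE x ∪ ((Nat.primesLE x).filter (fun p => p ^ 2 ≤ x)).image (fun p => p ^ 2))).filter (fun qq : ℕ × ℕ => ¬ Nat.Coprime qq.1 qq.2),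
              (1 : ℝ) / ((qq.1 : ℝ) * (qq.2 : ℝ)) := by
            refine mul_le_mul_of_nonneg_left ?_ hM4
            refine sum_le_sum_of_subset_of_nonneg ?_ fun qq _ _ => by positivity
            exact filter_subset_filter _ (product_subset_product (PP_mono hzx) (PP_mono hzx))
        _ ≤ (M₀ + 4 * D ^ 2) * 8 := mul_le_mul_of_nonneg_left h8 hM4
    have hB2 : ∑ qq ∈ ((Nat.primesLE z ∪ ((Nat.primesLE z).filter (fun p => p ^ 2 ≤ z)).image (fun p => p ^ 2)) ×ˢ (Nat.primesLE z ∪ ((Nat.primesLE z).filter (fun p => p ^ 2 ≤ z)).image (fun p => p ^ 2))).filter (fun qq : ℕ × ℕ => ¬ Nat.Coprime qq.1 qq.2),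
        (if qq.1 = qq.2 then (0 : ℝ) else 2 * D / ((max qq.1 qq.2 : ℕ) : ℝ)) ≤ 2 * D * 2 := by
      rw [sum_ite, sum_const_zero, zero_add, filter_filter]
      calc ∑ qq ∈ ((Nat.primesLE z ∪ ((Nat.primesLE z).filter (fun p => p ^ 2 ≤ z)).image (fun p => p ^ 2)) ×ˢ (Nat.primesLE z ∪ ((Nat.primesLE z).filter (fun p => p ^ 2 ≤ z)).image (fun p => p ^ 2))).filter (fun qq : ℕ × ℕ => ¬ Nat.Coprime qq.1 qq.2 ∧ ¬ qq.1 = qq.2),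
            2 * D / ((max qq.1 qq.2 : ℕ) : ℝ)
          = 2 * D * ∑ qq ∈ ((Nat.primesLE z ∪ ((Nat.primesLE z).filter (fun p => p ^ 2 ≤ z)).image (fun p => p ^ 2)) ×ˢ (Nat.primesLE z ∪ ((Nat.primesLE z).filter (fun p => p ^ 2 ≤ z)).image (fun p => p ^ 2))).filter (fun qq : ℕ × ℕ => ¬ Nat.Coprime qq.1 qq.2 ∧ qq.1 ≠ qq.2),
              (1 : ℝ) / ((max qq.1 qq.2 : ℕ) : ℝ) := by
            rw [mul_sum]
            exact sum_congr rfl fun qq _ => by ring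
        _ ≤ 2 * D * 2 := mul_le_mul_of_nonneg_left (sum_PP_not_coprime_ne_inv_max_le_two z) (by positivity)
    rw [sum_add_distrib]
    nlinarith [hA, hB1, hB2]
  have hfinal := add_le_add hdiag hoff
  rw [hM₀] at hfinal
  linarith [hfinal]

end Summit.Parity.BatemanHorn.Cruxes.SystemMomentDeficit.MassCount
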